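import Mathlib
import Summits.NavierStokesRegularity.NavierStokesRegularity.Theorems.FilamentSkeletonRssStadiumPairPositivity
import Summits.NavierStokesRegularity.NavierStokesRegularity.Theorems.FilamentSkeletonRssStadiumChordVariance
import Summits.NavierStokesRegularity.NavierStokesRegularity.Theorems.FilamentSkeletonRssStadiumPairAveragingIntegrable
import Summits.NavierStokesRegularity.NavierStokesRegularity.Theorems.FilamentSkeletonRssStadiumSplitProfile

/-!
# Route `FilamentSkeletonRss` · child crux `TangentSkeletonNearStraightL` (stmt-NavierStokesRegularity-23320) · registered line
# `child_tangent_analytic_strip_L` (b0b56c52900dd90a), stub `stub_stripPropagation` — assembly piece: THE HYBRID (position-split) CHORD BOUND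

Fifth assembly piece of the quarter-width blueprint (evidence `CORNER-QUARTER-BLUEPRINT-leafhand-15-g0.md` v3 on 23320): the positivity tool
for descent sources at intermediate distance from the target (`0.2·hs ≲ |Re(z−ζ)| ≲ 0.5·hs`), where neither the short-chord second-order bound
(`Theorems.StadiumDescentShortChord`) nor the foot estimate (`Theorems.StadiumFootClosedForm`) alone has margin.  Along the chord
`r ↦ z + r·s` (`r = 0` at the target's partner end, any orientation) the caller supplies: a real unit tangent field `T` with oscillation `≤ ρ`,
sup bounds `E`, `Q⁰` of the real-part / imaginary deviations on the whole chord (`Theorems.StadiumLegProfiles.chord_profiles`), and on the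
near part `(θ,1]` a continuous modulus `G` with `‖F′(z+rs) − F′(z+r′s)‖ ≤ |G r − G r′|` (an antiderivative of `‖s‖·M/d` along the chord,
`Theorems.StadiumCauchyNumerator`).  Pairs in `(θ,1]²` are bounded at second order (`Theorems.StadiumChordVariance.norm_sum_mul_sub_one_le`),
the others at first order (`Theorems.StadiumPairPositivity`); the double means are the separable closed forms of
`Theorems.StadiumSplitProfile.split_double_mean_eq`, and `Theorems.StadiumPairAveragingIntegrable.chord_sq_re_ge_of_pairwise_integrable` gives
  `Re(s²)·(1 − Φ) − |Im(s²)|·Ψ ≤ Re Σᵢ (Fᵢ(z+s) − Fᵢ(z))²`,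
  `Φ = θ(2−θ)(ρ+2E)²/2 + 3((1−θ)∫_θ¹G² − (∫_θ¹G)²)`, `Ψ = θ(2−θ)·2Q⁰(ρ+2E) + 3((1−θ)∫_θ¹G² − (∫_θ¹G)²)`   (`hybrid_chord_re_ge`).
Certified-form corner number: with this tool on the descent, `+0.086` (`Rb = 1/2`, `diag/split_pos.out`).
HONEST FRAMING: bookkeeping for a HYPOTHETICAL filament skeleton on the NEGATIVE side of a MODEL route; the stub `stub_stripPropagation` is NOT
closed by this file; nothing here bears on Navier–Stokes regularity or blow-up.  `--supports stmt-NavierStokesRegularity-23320`.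
-/

set_option linter.dupNamespace false

noncomputable section

namespace Summit.NavierStokesRegularity.NavierStokesRegularity.Theorems.StadiumHybridChord

open Set MeasureTheory
open scoped BigOperators
open Summit.NavierStokesRegularity.NavierStokesRegularity.Theorems.StadiumPairPositivity
open Summit.NavierStokesRegularity.NavierStokesRegularity.Theorems.StadiumChordVariance
open Summit.NavierStokesRegularity.NavierStokesRegularity.Theorems.StadiumPairAveragingIntegrable
open Summit.NavierStokesRegularity.NavierStokesRegularity.Theorems.StadiumSplitProfile

/-- **Hybrid (position-split) chord bound.**  `U` open, `F : ℂ → ℂ³` differentiable on `U` with `Σ (F′)ᵢ² = 1`, the segment `z + [0,1]·s ⊆ U`;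
a real unit tangent field `T` along it with oscillation `≤ ρ`; sup deviations `E` (real part from `T`) and `Q⁰` (imaginary part) on the whole
chord; a split parameter `0 ≤ θ ≤ 1` and a continuous `G` with `‖F′(z+rs) − F′(z+r′s)‖ ≤ |G r − G r′|` for `r, r′ ∈ (θ,1]`; and
`0 ≤ Re(s²)`.  Then with `V = 3((1−θ)∫_θ¹G² − (∫_θ¹G)²)`:
`Re(s²)(1 − (θ(2−θ)(ρ+2E)²/2 + V)) − |Im(s²)|(θ(2−θ)(2Q⁰(ρ+2E)) + V) ≤ Re Σᵢ (Fᵢ(z+s) − Fᵢ(z))²`. [folklore] -/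
theorem hybrid_chord_re_ge {U : Set ℂ} (hU : IsOpen U) {F : ℂ → (Fin 3 → ℂ)} (hF : DifferentiableOn ℂ F U)
    (hunit : ∀ w ∈ U, ∑ i, (deriv F w i) ^ 2 = 1) {z s : ℂ} (hseg : ∀ r ∈ Icc (0:ℝ) 1, z + (r : ℂ) * s ∈ U)
    (T : ℝ → Fin 3 → ℝ) (hT : ∀ r ∈ Icc (0:ℝ) 1, ∑ i, T r i ^ 2 = 1) {ρ E Q₀ : ℝ}
    (hρ : ∀ r ∈ Icc (0:ℝ) 1, ∀ r' ∈ Icc (0:ℝ) 1, √(∑ i, (T r i - T r' i) ^ 2) ≤ ρ)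
    (he : ∀ r ∈ Icc (0:ℝ) 1, √(∑ i, ((deriv F (z + (r : ℂ) * s) i).re - T r i) ^ 2) ≤ E)
    (hq : ∀ r ∈ Icc (0:ℝ) 1, √(∑ i, (deriv F (z + (r : ℂ) * s) i).im ^ 2) ≤ Q₀)
    {θ : ℝ} (hθ0 : 0 ≤ θ) (hθ1 : θ ≤ 1) {G : ℝ → ℝ} (hG : Continuous G)
    (hLip : ∀ r ∈ Icc (0:ℝ) 1, ∀ r' ∈ Icc (0:ℝ) 1, θ < r → θ < r' →
      ‖deriv F (z + (r : ℂ) * s) - deriv F (z + (r' : ℂ) * s)‖ ≤ |G r - G r'|)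
    (hs : 0 ≤ (s ^ 2).re) :
    (s ^ 2).re * (1 - (θ * (2 - θ) * ((ρ + 2 * E) ^ 2 / 2) +
        3 * ((1 - θ) * (∫ r in θ..1, G r ^ 2) - (∫ r in θ..1, G r) ^ 2))) -
      |(s ^ 2).im| * (θ * (2 - θ) * (2 * Q₀ * (ρ + 2 * E)) +
        3 * ((1 - θ) * (∫ r in θ..1, G r ^ 2) - (∫ r in θ..1, G r) ^ 2)) ≤
      (∑ i, (F (z + s) i - F z i) ^ 2).re := by
  set a : ℝ → (Fin 3 → ℂ) := fun r => deriv F (z + (r : ℂ) * s) with ha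
  -- the two pair profiles
  set φ : ℝ → ℝ → ℝ := fun r r' => if θ < r ∧ θ < r' then (3 / 2 : ℝ) * (G r - G r') ^ 2 else (ρ + 2 * E) ^ 2 / 2 with hφ
  set ψ : ℝ → ℝ → ℝ := fun r r' => if θ < r ∧ θ < r' then (3 / 2 : ℝ) * (G r - G r') ^ 2 else 2 * Q₀ * (ρ + 2 * E) with hψ
  -- second order on the near square
  have hnear : ∀ r ∈ Icc (0:ℝ) 1, ∀ r' ∈ Icc (0:ℝ) 1, θ < r → θ < r' →
      ‖∑ i, a r i * a r' i - 1‖ ≤ (3 / 2 : ℝ) * (G r - G r') ^ 2 := by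
    intro r hr r' hr' h1 h2
    have hb := norm_sum_mul_sub_one_le (a r) (a r') (hunit _ (hseg r hr)) (hunit _ (hseg r' hr'))
    have hL := hLip r hr r' hr' h1 h2
    have hsq : ‖a r - a r'‖ ^ 2 ≤ (G r - G r') ^ 2 := by
      have h := pow_le_pow_left₀ (norm_nonneg _) hL 2
      rwa [sq_abs] at h
    calc ‖∑ i, a r i * a r' i - 1‖ ≤ (3 / 2 : ℝ) * ‖a r - a r'‖ ^ 2 := hb
      _ ≤ (3 / 2 : ℝ) * (G r - G r') ^ 2 := mul_le_mul_of_nonneg_left hsq (by norm_num)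
  -- first order everywhere
  have hfirst_re : ∀ r ∈ Icc (0:ℝ) 1, ∀ r' ∈ Icc (0:ℝ) 1, 1 - (ρ + 2 * E) ^ 2 / 2 ≤ (∑ i, a r i * a r' i).re := by
    intro r hr r' hr'
    have h := re_dot_ge_of_le (a r) (a r') (T r) (T r') (hunit _ (hseg r hr)) (hunit _ (hseg r' hr')) (hT r hr) (hT r' hr')
      (hρ r hr r' hr') (he r hr) (he r' hr')
    have e : ρ + E + E = ρ + 2 * E := by ring
    rw [e] at h; exact h
  have hfirst_im : ∀ r ∈ Icc (0:ℝ) 1, ∀ r' ∈ Icc (0:ℝ) 1, |(∑ i, a r i * a r' i).im| ≤ 2 * Q₀ * (ρ + 2 * E) := by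
    intro r hr r' hr'
    have h := abs_im_dot_le_of_le (a r) (a r') (T r) (T r') (hunit _ (hseg r hr)) (hunit _ (hseg r' hr'))
      (hρ r hr r' hr') (he r hr) (he r' hr') (hq r hr) (hq r' hr')
    have e : (Q₀ + Q₀) * (ρ + E + E) = 2 * Q₀ * (ρ + 2 * E) := by ring
    rw [e] at h; exact h
  -- the profiles bound the pair products
  have hpairφ : ∀ r ∈ Icc (0:ℝ) 1, ∀ r' ∈ Icc (0:ℝ) 1, 1 - φ r r' ≤ (∑ i, a r i * a r' i).re := by
    intro r hr r' hr'
    by_cases h : θ < r ∧ θ < r'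
    · simp only [hφ, if_pos h]
      have hn := hnear r hr r' hr' h.1 h.2
      have h1 := Complex.abs_re_le_norm (∑ i, a r i * a r' i - 1)
      have h2 := neg_abs_le (∑ i, a r i * a r' i - 1).re
      rw [Complex.sub_re, Complex.one_re] at h1 h2
      linarith
    · simp only [hφ, if_neg h]
      exact hfirst_re r hr r' hr'
  have hpairψ : ∀ r ∈ Icc (0:ℝ) 1, ∀ r' ∈ Icc (0:ℝ) 1, |(∑ i, a r i * a r' i).im| ≤ ψ r r' := by
    intro r hr r' hr'
    by_cases h : θ < r ∧ θ < r'
    · simp only [hψ, if_pos h]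
      have hn := hnear r hr r' hr' h.1 h.2
      have h1 := Complex.abs_im_le_norm (∑ i, a r i * a r' i - 1)
      rw [Complex.sub_im, Complex.one_im, sub_zero] at h1
      exact h1.trans hn
    · simp only [hψ, if_neg h]
      exact hfirst_im r hr r' hr'
  -- integrability and closed forms of the double means
  obtain ⟨hφi, hΦi, hΦv⟩ := split_double_mean_eq (C := (ρ + 2 * E) ^ 2 / 2) hθ0 hθ1 hG
  obtain ⟨hψi, hΨi, hΨv⟩ := split_double_mean_eq (C := 2 * Q₀ * (ρ + 2 * E)) hθ0 hθ1 hG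
  have h := chord_sq_re_ge_of_pairwise_integrable hU hF hseg hφi hΦi hψi hΨi hpairφ hpairψ hs
  rw [hΦv, hΨv] at h
  linarith [h]

end Summit.NavierStokesRegularity.NavierStokesRegularity.Theorems.StadiumHybridChord

end
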